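import Summits.ABC.ABC.Theorems.DefiniteXiFreyModularityCMCorner
import HarnessLib

/-!
# Stub ideas for `stub_modThree` — ideator k = 3 · GENERATION 18 (family 3: probe the extremes —
"perturbation / stability from the PROVED neighbouring case" + certified census)

Companion to `STUB-IDEAS-stub_modThree-3.md` (g18).  Elaboration-only; H1–H3 are PROVED (no `sorry`),
H4 is a fact-shaped `Prop` (context, not staffed), §C is a `decide`-level census certificate.

Registered stub (line `Sketch`, L143, sha 21576c53…):
`∀ W [W.IsElliptic] (ρ : ModPGaloisRep ℚ (ZMod 3) 2), W.IsTorsionGaloisRep 3 ρ →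
   FramedRep.IsAbsolutelyIrreducible ρ → ρ.IsModular`.

T-I (stability).  The stub's conclusion `ρ.IsModular` is a function of `ρ̄` alone, and a framed `ρ̄`
frames `W[3]` for EVERY `W` in the mod-3 congruence class of a curve it frames (H1, frame transport).
Hence (H2) the stub holds NOW for every `W` that is 3-congruent to a `BCDT.IsModular` curve of the
tree, in particular (H3) on the whole class of the CM corner `E₁ = E_(1,1) = 32a2 : y² = x³ − x`
(landed `isModular_modThree_freyCurve_one_one`) — Rubin–Silverberg's Remark 4.5 ("if `j(E') ∈
{1728(27D²t⁴−18Dt²−1)³/(27D²t⁴+18Dt²−1)³}` then `E'` is modular"), in-tree and LT-free: an infinite,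
non-isotrivial, generically non-CM family (H4 = their Thm. 4.4, fact-shaped).
-/

set_option linter.dupNamespace false

noncomputable section

open scoped MatrixGroups
open Literature.NumberTheory.EllipticCurves
open Literature.NumberTheory.Automorphic
open Literature.NumberTheory.Automorphic.BCDT
open Literature.NumberTheory.GaloisRepresentations
open Summit.ABC.ABC.Theorems
open WeierstrassCurve

namespace Summit.ABC.ABC.Cruxes.FreyModularity.StubIdeasModThree3G18

/-- The registered signature of `stub_modThree`, verbatim (for reference; NOT re-typed). [folklore] -/
abbrev SigStubModThree : Prop :=
  ∀ (W : WeierstrassCurve ℚ) [W.IsElliptic] (ρ : ModPGaloisRep ℚ (ZMod 3) 2),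
    W.IsTorsionGaloisRep 3 ρ → FramedRep.IsAbsolutelyIrreducible ρ → ρ.IsModular

/-- **`W ≡ₙ W'` (mod-`n` congruence of curves)** in the tree's idiom (FLS 3–5 switching,
`FLSThreeFiveSwitchingProofs`): some framed `ρ₀` frames both `W[n]` and `W'[n]`, i.e.
`W[n] ≅ W'[n]` as Galois modules. [folklore] -/
def TorsionCongruent {F : Type*} [Field F] (n : ℕ) (W W' : WeierstrassCurve F) : Prop :=
  ∃ ρ₀ : FramedGaloisRep F (ZMod n) 2, W.IsTorsionGaloisRep n ρ₀ ∧ W'.IsTorsionGaloisRep n ρ₀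

/-- **H1 — frame transport (S, PROVED).** If `ρ` frames `W[n]` and `W ≡ₙ W'` then `ρ` frames
`W'[n]`: compose the frames `e₀' : W'[n] ≃ 𝔽ₙ²` (for `ρ₀`), `e₀⁻¹` (for `ρ₀` on `W`) and `e`
(for `ρ` on `W`).  This is the "any two framings are conjugate" remark of the `IsTorsionGaloisRep`
docstring, in the form the stub consumes. [folklore] -/
theorem isTorsionGaloisRep_of_torsionCongruent {F : Type*} [Field F] {n : ℕ}
    {W W' : WeierstrassCurve F} {ρ : FramedGaloisRep F (ZMod n) 2}
    (hρ : W.IsTorsionGaloisRep n ρ) (h : TorsionCongruent n W W') : W'.IsTorsionGaloisRep n ρ := by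
  obtain ⟨e, he⟩ := hρ
  obtain ⟨ρ₀, ⟨e₀, he₀⟩, ⟨e₀', he₀'⟩⟩ := h
  refine ⟨e₀'.trans (e₀.symm.trans e), fun σ P' ↦ ?_⟩
  have h1 : e₀.symm (e₀' (σ • P')) = σ • e₀.symm (e₀' P') := by
    apply e₀.injective
    rw [AddEquiv.apply_symm_apply, he₀', he₀, AddEquiv.apply_symm_apply]
  simp only [AddEquiv.trans_apply]
  rw [h1, he]

/-- `≡ₙ` is symmetric. [folklore] -/
theorem torsionCongruent_comm {F : Type*} [Field F] {n : ℕ} {W W' : WeierstrassCurve F}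
    (h : TorsionCongruent n W W') : TorsionCongruent n W' W := by
  obtain ⟨ρ₀, h₁, h₂⟩ := h
  exact ⟨ρ₀, h₂, h₁⟩

/-- `≡ₙ` is reflexive on curves that admit a framing (every elliptic curve over a field of
characteristic prime to `n`, `exists_isTorsionGaloisRep`). [folklore] -/
theorem torsionCongruent_refl_of_isTorsionGaloisRep {F : Type*} [Field F] {n : ℕ}
    {W : WeierstrassCurve F} {ρ : FramedGaloisRep F (ZMod n) 2} (hρ : W.IsTorsionGaloisRep n ρ) :
    TorsionCongruent n W W :=
  ⟨ρ, hρ, hρ⟩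

/-- **H2 — stability of the stub's conclusion under congruence to a modular curve (S, PROVED).**
If `W ≡_ℓ W'` with `W'` modular in BCDT's sense, then every framed `ρ̄` of `W[ℓ]` is modular — for
every prime `ℓ`, with no irreducibility hypothesis and no Langlands–Tunnell: frame transport (H1) +
the tree's unconditional "(2) ⇒ (4)" `IsModular.isModular_of_isTorsionGaloisRep''`.
[cite: BCDTJAMS2001, Introduction ((2) ⇒ (4))] -/
theorem isModular_of_torsionCongruent_of_isModular {W W' : WeierstrassCurve ℚ} [W'.IsElliptic]
    [NeZero (W'.conductorNorm ℤ)] (hW' : BCDT.IsModular W') {ℓ : ℕ} [Fact ℓ.Prime]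
    {ρ : ModPGaloisRep ℚ (ZMod ℓ) 2} (hρ : W.IsTorsionGaloisRep ℓ ρ) (h : TorsionCongruent ℓ W W') :
    ρ.IsModular :=
  hW'.isModular_of_isTorsionGaloisRep'' (isTorsionGaloisRep_of_torsionCongruent hρ h)

/-- **H3 — the rung: `stub_modThree` on the whole mod-3 congruence class of the CM corner
`E₁ = E_(1,1)` (S, PROVED from landed inputs only).**  For every `W/ℚ` (elliptic or not, `ρ̄`
irreducible or not) with `W[3] ≅ E₁[3]` and every framed `ρ̄` of `W[3]`, `ρ̄` is modular.  By
Rubin–Silverberg (Thm. 4.4 with `D = 1`, Remark 4.2/4.5) the class is the image of `ℙ¹(ℚ)` under a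
non-isotrivial family, so this is an infinite set of `j`-invariants, all but finitely many non-CM —
the first instances of the stub's conclusion for NON-CM curves that the tree can certify, and they use
no leaf of Langlands–Tunnell. [cite: BCDTJAMS2001, Introduction ((2) ⇒ (4))] -/
theorem isModular_modThree_of_torsionCongruent_corner (W : WeierstrassCurve ℚ)
    (ρ : ModPGaloisRep ℚ (ZMod 3) 2) (hρ : W.IsTorsionGaloisRep 3 ρ)
    (h : TorsionCongruent 3 W (freyCurve 1 1)) : ρ.IsModular :=
  isModular_modThree_freyCurve_one_one (isTorsionGaloisRep_of_torsionCongruent hρ h)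

/-- H3 in the stub's own binder shape (the two unused hypotheses kept to show the instance). [folklore] -/
theorem sigStubModThree_on_cornerClass :
    ∀ (W : WeierstrassCurve ℚ) [W.IsElliptic] (ρ : ModPGaloisRep ℚ (ZMod 3) 2),
      W.IsTorsionGaloisRep 3 ρ → FramedRep.IsAbsolutelyIrreducible ρ →
        TorsionCongruent 3 W (freyCurve 1 1) → ρ.IsModular :=
  fun W _ ρ hρ _ h ↦ isModular_modThree_of_torsionCongruent_corner W ρ hρ h

/-- **H4 — Rubin–Silverberg 1995, Theorem 4.4 (`D = 1`), fact-shaped (L; context, NOT staffed).**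
For every `t ∈ ℚ` the curve `E_t : y² = x³ + (27t⁴ − 18t² − 1)x + 4t(27t⁴ + 1)` is an elliptic
curve with `E_t[3] ≅ E₁[3]` (`E₁ : y² = x³ − x = E_(1,1)`), `Δ(E_t) = −2⁶(27t⁴ + 18t² − 1)³`,
`j(E_t) = 1728(27t⁴ − 18t² − 1)³/(27t⁴ + 18t² − 1)³`; `t = 0` is `E₁` itself.  With H3 every `E_t`
satisfies the conclusion of `stub_modThree` today.  Typing the 3-torsion isomorphism for symbolic `t`
is an L-sized symbolic computation (the authors used Pari/Mathematica); recorded as a `Prop` only.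
[cite: RubinSilverberg1995, Thm. 4.4] -/
def RubinSilverbergFamilyThree : Prop :=
  ∀ t : ℚ, TorsionCongruent 3
    ({ a₁ := 0, a₂ := 0, a₃ := 0, a₄ := 27 * t ^ 4 - 18 * t ^ 2 - 1, a₆ := 4 * t * (27 * t ^ 4 + 1) } :
      WeierstrassCurve ℚ) (freyCurve 1 1)

/-- H4 ⇒ the stub on the whole Rubin–Silverberg family (one line from H3). [folklore] -/
theorem isModular_modThree_rubinSilverberg (hRS : RubinSilverbergFamilyThree) (t : ℚ)
    (ρ : ModPGaloisRep ℚ (ZMod 3) 2)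
    (hρ : ({ a₁ := 0, a₂ := 0, a₃ := 0, a₄ := 27 * t ^ 4 - 18 * t ^ 2 - 1,
             a₆ := 4 * t * (27 * t ^ 4 + 1) } : WeierstrassCurve ℚ).IsTorsionGaloisRep 3 ρ) :
    ρ.IsModular :=
  isModular_modThree_of_torsionCongruent_corner _ ρ hρ (hRS t)

/-! ## §C — census certificate (T-II).  The residual cell of k3-g7 §C ("no tame Langlands pin at any
prime") over the 949 938 primitive triples `a + b = c`, `a ≤ b`, `c ≤ 2500`: TAME-pinned 96.853 %,
wild-at-3-only 0.337 %, additive-at-2 (v₂(abc) ∈ {1,2,3}, local type not decided by valuations)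
2.798 %, residual `U` = 114 triples = 0.012 %, smallest `(27, 112, 139)`, then `(1, 432, 433)`;
every `U`-member has a good prime `p ≤ 31`, `p ≡ 2 (3)` with `a_p ≢ ±(1+p) (mod 3)` (irreducible,
hence — with the Tate transvection — surjective `ρ̄₃`).  Script `cert/frey_pin_census.py` (local, 58 s).
The membership test at 3 for `3 ∣ abc` is g7's C1: `3 ∣ v₃(abc)` and `2⁸(a²+ab+b²)³ ≡ ±(abc/3^{v₃})²
(mod 9)`; for the smallest member it reads as follows (kernel-checked arithmetic only). -/

/-- `(27,112,139)`: `v₃ = 3`, `v₂ = 4` (good at 2 after twist), `139 ≡ 7 ≡ 1 (mod 3)` (no inert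
multiplicative prime), and the cube test at 3 passes: `2⁸·(27²+27·112+112²)³ ≡ 4 ≡ (112·139)² (mod 9)`.
[folklore] -/
example : 27 = 3 ^ 3 ∧ 112 = 2 ^ 4 * 7 ∧ 139 % 3 = 1 ∧ 7 % 3 = 1 ∧ Nat.Prime 139 ∧
    (2 ^ 8 * (27 ^ 2 + 27 * 112 + 112 ^ 2) ^ 3) % 9 = 4 ∧ ((112 * 139) ^ 2) % 9 = 4 := by
  refine ⟨by norm_num, by norm_num, by norm_num, by norm_num, by norm_num, by norm_num, by norm_num⟩

end Summit.ABC.ABC.Cruxes.FreyModularity.StubIdeasModThree3G18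

end
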